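import Literature.AlgebraicGeometry.Modules.SchemeLinearisation
import Literature.AlgebraicGeometry.RelativeSpec.EquivariantModuleInvariants
import HarnessLib

/-!
# The UNIT SLICE on a torsor chart: the codegeneracy `d = u♯ : Γ(W) → Γ(U)` and the counit
# `ε : Γ(W, pr₂^* E) → Γ(U, E)` with `d ∘ act♯ = id = d ∘ pr₂♯`, `ε (s • y) = d s • ε y`, `ε ∘ j₂ = id`,
# and — from the unit axiom of a linearisation — `ε ∘ Φ_W ∘ j₁ = id`

P6b wave C, seam s20 («counit ∕ unit-slice chart»).  Currency = the ABSTRACT kernel pair of ★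
`RelativeSpec/TorsorQuotientDescent` ∕ organ (ii) Dγ-chart: `act pr₂ : P ⟶ O` over `S`, an open `U ⊆ O`
(the consumer takes `U := q⁻¹V`), the chart `W := act⁻¹U ⊓ pr₂⁻¹U ⊆ P`, the two unit-section maps
`j₁ x := η_act(x)|_W ∈ Γ(W, act^* E)`, `j₂ x := η_pr₂(x)|_W ∈ Γ(W, pr₂^* E)` (★ `Modules.unitSectionLE`), a morphism
`Φ : act^* E ⟶ pr₂^* E` (the `.iso.hom` of a ★ `Modules.Linearisation`), and a SECTION `u : O ⟶ P` of both `act` and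
`pr₂` (`u ≫ act = 𝟙 = u ≫ pr₂`; the consumer takes `u := unitSlice G X`, ★ `unitSlice_act_left`, `unitSlice_snd_left`).

* §1 `sectionPullbackIso_hom_app_unitSection` — the engine: ★ `Modules.sectionPullbackIso h E : u^* a^* E ≅ E`
  (`h : u ≫ a = 𝟙`) sends `η_u(η_a(m))` to `m` (transported along `u⁻¹a⁻¹V = V`).
* §2 the CODEGENERACY `d := u♯ = u.appLE W U _ : Γ(W, 𝒪_P) → Γ(U, 𝒪_O)`: `le_preimage_inf` (`U ≤ u⁻¹W`),
  `appLE_section_appLE_act` (`d (act♯ s) = s`), `appLE_section_appLE_snd` (`d (pr₂♯ s) = s`).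
* §3 the COUNIT `ε y := (sectionPullbackIso hu₂ E).hom.app U (η_u(y)|_U)` for `y ∈ Γ(W, pr₂^* E)`:
  `counitSection_add`, `counitSection_smul` (`ε (s • y) = d s • ε y`), `counitSection_unitSectionLE_snd` (`ε (j₂ x) = x`).
* §4 `counitSection_app_unitSectionLE_act` — **`ε (Φ_W (j₁ x)) = x`** from the UNIT AXIOM in the shape of ★
  `Modules.Linearisation.iso_unit_hom`: `u^* Φ = can₁ ≫ can₂⁻¹`.

These are EXACTLY the counit tokens `(d, ε, hd, hε, hεj, hunit)` of the ring-side descent datum (organ (ii)-alg,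
`RingTheory/Flat/ModuleDescentData` §0), read on the scheme chart.  THEOREMS ONLY (the maps `d`, `ε` appear as the
explicit terms above, no `def`); no instance, no sorry.

## References
* [MumfordFogartyKirwan1994] D. Mumford, J. Fogarty, F. Kirwan, *Geometric Invariant Theory* (1994), Ch. 1 §3 Def. 1.6 (p. 30).
* [MumfordAV1970] D. Mumford, *Abelian Varieties* (1970), §12 Thm. 1 (p. 111) and its proof (p. 112).
-/

noncomputable section

-- `TopCat.Presheaf`/`Scheme.Modules` are not reducible (as in Mathlib's `AlgebraicGeometry/Modules`).
set_option backward.isDefEq.respectTransparency false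

universe u

open CategoryTheory Limits AlgebraicGeometry TopologicalSpace Opposite
open Literature.AlgebraicGeometry.Modules Literature.AlgebraicGeometry.HodgeTheory

namespace Literature.AlgebraicGeometry.RelativeSpec

/-! ## §1 The engine: `u^* a^* E ≅ E` on unit sections -/

section Engine

variable {Y Z : Scheme.{u}} {v : Y ⟶ Z} {a : Z ⟶ Y}

/-- `v⁻¹(a⁻¹V) = V` for a section `v` of `a`. [cite: MumfordFogartyKirwan1994, Ch. 1 §3 Def. 1.6 (p. 30)] -/
theorem preimage_preimage_eq_of_comp_eq_id (h : v ≫ a = 𝟙 Y) (V : Y.Opens) : v ⁻¹ᵁ (a ⁻¹ᵁ V) = V := by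
  rw [← Scheme.Hom.comp_preimage, h]
  rfl

/-- **`can : v^* a^* E ≅ E` sends `η_v(η_a(m))` to `m`** (for `v ≫ a = 𝟙`; ★ `Modules.sectionPullbackIso` =
`pullbackComp ≪≫ pullbackCongr ≪≫ pullbackId` read on unit sections, the result transported along `v⁻¹a⁻¹V = V`).
[cite: MumfordFogartyKirwan1994, Ch. 1 §3 Def. 1.6 (p. 30)] -/
theorem sectionPullbackIso_hom_app_unitSection (h : v ≫ a = 𝟙 Y) (E : Y.Modules) (V : Y.Opens) (m : Γ(E, V)) :
    (sectionPullbackIso h E).hom.app (v ⁻¹ᵁ (a ⁻¹ᵁ V))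
        (unitSection v ((Scheme.Modules.pullback a).obj E) (a ⁻¹ᵁ V) (unitSection a E V m)) =
      E.presheaf.map (eqToHom (preimage_preimage_eq_of_comp_eq_id h V)).op m := by
  simp only [sectionPullbackIso, Iso.trans_hom, Iso.app_hom, Scheme.Modules.Hom.comp_app,
    CategoryTheory.comp_apply]
  erw [pullbackComp_hom_app_unitSection v a E V m]
  erw [Modules.pullbackCongr_hom_app_unitSection E h V m]
  erw [app_presheaf_map ((Scheme.Modules.pullbackId Y).hom.app E)]
  erw [pullbackId_hom_app_unitSection E V m]
  exact Modules.presheaf_map_congr _ _ _ _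

end Engine

/-! ## §2 The codegeneracy `d = u♯ : Γ(W) → Γ(U)` -/

namespace TorsorQuotient

section Chart

variable {S : Scheme.{u}} {P O : Over S} (act pr₂ : P ⟶ O) (u : O ⟶ P)
  (hu₁ : u.left ≫ act.left = 𝟙 O.left) (hu₂ : u.left ≫ pr₂.left = 𝟙 O.left) (U : O.left.Opens)

include hu₁ hu₂ in
/-- `U ≤ u⁻¹(act⁻¹U ⊓ pr₂⁻¹U)` (indeed `=`): the unit slice of `U` lies in the chart `W`.
[cite: MumfordFogartyKirwan1994, Ch. 1 §3 Def. 1.6 (p. 30)] -/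
theorem le_preimage_inf : U ≤ u.left ⁻¹ᵁ (act.left ⁻¹ᵁ U ⊓ pr₂.left ⁻¹ᵁ U) := by
  rw [Scheme.Hom.preimage_inf, preimage_preimage_eq_of_comp_eq_id hu₁, preimage_preimage_eq_of_comp_eq_id hu₂, inf_idem]

variable (hW : U ≤ u.left ⁻¹ᵁ (act.left ⁻¹ᵁ U ⊓ pr₂.left ⁻¹ᵁ U))

include hu₁ in
/-- **`d (act♯ s) = s`**: `u♯ ∘ act♯ = (u ≫ act)♯ = id` on `Γ(U)`. [cite: MumfordFogartyKirwan1994, Ch. 1 §3 Def. 1.6 (p. 30)] -/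
theorem appLE_section_appLE_act (s : Γ(O.left, U)) :
    u.left.appLE (act.left ⁻¹ᵁ U ⊓ pr₂.left ⁻¹ᵁ U) U hW
        (act.left.appLE U (act.left ⁻¹ᵁ U ⊓ pr₂.left ⁻¹ᵁ U) inf_le_left s) = s := by
  rw [← CategoryTheory.comp_apply, Scheme.Hom.appLE_comp_appLE]
  have key : ∀ {f : O.left ⟶ O.left} (_ : f = 𝟙 O.left) (e : U ≤ f ⁻¹ᵁ U), f.appLE U U e s = s := by
    rintro f rfl e
    simp only [Scheme.Hom.appLE, Scheme.Hom.id_app, Category.id_comp]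
    rw [Subsingleton.elim (homOfLE e).op (𝟙 (op U))]
    erw [CategoryTheory.Functor.map_id]
    rfl
  exact key hu₁ _

include hu₂ in
/-- **`d (pr₂♯ s) = s`**: `u♯ ∘ pr₂♯ = (u ≫ pr₂)♯ = id` on `Γ(U)`. [cite: MumfordFogartyKirwan1994, Ch. 1 §3 Def. 1.6 (p. 30)] -/
theorem appLE_section_appLE_snd (s : Γ(O.left, U)) :
    u.left.appLE (act.left ⁻¹ᵁ U ⊓ pr₂.left ⁻¹ᵁ U) U hW
        (pr₂.left.appLE U (act.left ⁻¹ᵁ U ⊓ pr₂.left ⁻¹ᵁ U) inf_le_right s) = s := by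
  rw [← CategoryTheory.comp_apply, Scheme.Hom.appLE_comp_appLE]
  have key : ∀ {f : O.left ⟶ O.left} (_ : f = 𝟙 O.left) (e : U ≤ f ⁻¹ᵁ U), f.appLE U U e s = s := by
    rintro f rfl e
    simp only [Scheme.Hom.appLE, Scheme.Hom.id_app, Category.id_comp]
    rw [Subsingleton.elim (homOfLE e).op (𝟙 (op U))]
    erw [CategoryTheory.Functor.map_id]
    rfl
  exact key hu₂ _

/-! ## §3 The counit `ε : Γ(W, pr₂^* E) → Γ(U, E)`, `ε y := can (η_u(y)|_U)` -/

variable (E : O.left.Modules)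

/-- `ε` is additive. [cite: MumfordFogartyKirwan1994, Ch. 1 §3 Def. 1.6 (p. 30)] -/
theorem counitSection_add (y y' : Γ((Scheme.Modules.pullback pr₂.left).obj E, act.left ⁻¹ᵁ U ⊓ pr₂.left ⁻¹ᵁ U)) :
    (sectionPullbackIso hu₂ E).hom.app U
        (unitSectionLE u.left ((Scheme.Modules.pullback pr₂.left).obj E) hW (y + y')) =
      (sectionPullbackIso hu₂ E).hom.app U (unitSectionLE u.left ((Scheme.Modules.pullback pr₂.left).obj E) hW y) +
        (sectionPullbackIso hu₂ E).hom.app U (unitSectionLE u.left ((Scheme.Modules.pullback pr₂.left).obj E) hW y') := by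
  rw [unitSectionLE_add, map_add]

/-- **`ε (s • y) = d s • ε y`** (`ε` is `u♯`-semilinear). [cite: MumfordFogartyKirwan1994, Ch. 1 §3 Def. 1.6 (p. 30)] -/
theorem counitSection_smul (c : Γ(P.left, act.left ⁻¹ᵁ U ⊓ pr₂.left ⁻¹ᵁ U))
    (y : Γ((Scheme.Modules.pullback pr₂.left).obj E, act.left ⁻¹ᵁ U ⊓ pr₂.left ⁻¹ᵁ U)) :
    (sectionPullbackIso hu₂ E).hom.app U
        (unitSectionLE u.left ((Scheme.Modules.pullback pr₂.left).obj E) hW (c • y)) =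
      u.left.appLE (act.left ⁻¹ᵁ U ⊓ pr₂.left ⁻¹ᵁ U) U hW c •
        (sectionPullbackIso hu₂ E).hom.app U (unitSectionLE u.left ((Scheme.Modules.pullback pr₂.left).obj E) hW y) := by
  rw [unitSectionLE_smul, Scheme.Modules.Hom.app_smul]

/-- **`ε (j₂ x) = x`**: `can (η_u(η_pr₂(x)|_W)|_U) = x`. [cite: MumfordFogartyKirwan1994, Ch. 1 §3 Def. 1.6 (p. 30)] -/
theorem counitSection_unitSectionLE_snd (x : Γ(E, U)) :
    (sectionPullbackIso hu₂ E).hom.app U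
        (unitSectionLE u.left ((Scheme.Modules.pullback pr₂.left).obj E) hW
          (unitSectionLE pr₂.left E (inf_le_right : act.left ⁻¹ᵁ U ⊓ pr₂.left ⁻¹ᵁ U ≤ _) x)) = x := by
  have e : u.left ⁻¹ᵁ (pr₂.left ⁻¹ᵁ U) = U := preimage_preimage_eq_of_comp_eq_id hu₂ U
  rw [unitSectionLE, unitSectionLE, unitSection_map,
    presheaf_map_map_congr _ _ _ (eqToHom e.symm), app_presheaf_map]
  erw [sectionPullbackIso_hom_app_unitSection hu₂ E U x]
  exact (presheaf_map_map_congr E _ _ (𝟙 U) x).trans (presheaf_map_self E _ x)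

/-! ## §4 The unit axiom of the linearisation: `ε (Φ_W (j₁ x)) = x` -/

/-- **`ε (Φ_W (j₁ x)) = x`** — the UNIT condition of a linearisation `Φ : act^* E ⟶ pr₂^* E` (in the shape of ★
`Modules.Linearisation.iso_unit_hom`: `u^* Φ = can_act ≫ can_pr₂⁻¹`) read on the chart: `can_pr₂ (η_u (Φ_W (η_act x|_W))|_U) = x`.
[cite: MumfordFogartyKirwan1994, Ch. 1 §3 Def. 1.6 (p. 30)] -/
theorem counitSection_app_unitSectionLE_act
    (Φ : (Scheme.Modules.pullback act.left).obj E ⟶ (Scheme.Modules.pullback pr₂.left).obj E)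
    (hΦu : (Scheme.Modules.pullback u.left).map Φ =
      (sectionPullbackIso hu₁ E).hom ≫ (sectionPullbackIso hu₂ E).inv)
    (x : Γ(E, U)) :
    (sectionPullbackIso hu₂ E).hom.app U
        (unitSectionLE u.left ((Scheme.Modules.pullback pr₂.left).obj E) hW
          (Φ.app (act.left ⁻¹ᵁ U ⊓ pr₂.left ⁻¹ᵁ U)
            (unitSectionLE act.left E (inf_le_left : act.left ⁻¹ᵁ U ⊓ pr₂.left ⁻¹ᵁ U ≤ _) x))) = x := by
  have e₁ : u.left ⁻¹ᵁ (act.left ⁻¹ᵁ U) = U := preimage_preimage_eq_of_comp_eq_id hu₁ U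
  -- (a) `η_u (Φ_W z) = (u^* Φ) (η_u z)`; (b) the unit axiom `u^* Φ = can₁ ≫ can₂⁻¹`
  rw [unitSectionLE, ← pullback_map_app_unitSection u.left Φ, hΦu]
  simp only [Scheme.Modules.Hom.comp_app, CategoryTheory.comp_apply]
  -- (c) `can₁ (η_u (η_act x|_W)) = x` restricted to `u⁻¹W`
  rw [unitSectionLE, unitSection_map,
    app_presheaf_map (sectionPullbackIso hu₁ E).hom
      ((Opens.map u.left.base).map (homOfLE (inf_le_left : act.left ⁻¹ᵁ U ⊓ pr₂.left ⁻¹ᵁ U ≤ act.left ⁻¹ᵁ U)))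
      (unitSection u.left ((Scheme.Modules.pullback act.left).obj E) (act.left ⁻¹ᵁ U) (unitSection act.left E U x))]
  erw [sectionPullbackIso_hom_app_unitSection hu₁ E U x]
  -- (d) move the restriction `|_U` through `can₂⁻¹`, cancel `can₂ ∘ can₂⁻¹`, collapse the three restrictions
  erw [← app_presheaf_map (sectionPullbackIso hu₂ E).inv (homOfLE hW)]
  rw [← CategoryTheory.comp_apply, ← Scheme.Modules.Hom.comp_app, Iso.inv_hom_id, Scheme.Modules.Hom.id_app,
    CategoryTheory.id_apply, presheaf_map_map_congr E _ _ (eqToHom e₁.symm),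
    presheaf_map_map_congr E _ _ (𝟙 U), presheaf_map_self]

end Chart

end TorsorQuotient

end Literature.AlgebraicGeometry.RelativeSpec

end
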